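import Literature.MathematicalPhysics.QuantumFieldTheory.Balaban1983to89.B9Eq315QAdjointBlockDecay
import Literature.MathematicalPhysics.QuantumFieldTheory.Balaban1983to89.B9Eq3126H1BlockDecayOfLetters
import Literature.MathematicalPhysics.QuantumFieldTheory.Balaban1983to89.B9Eq3126H1BlockDecayOfLettersTower
import Literature.MathematicalPhysics.QuantumFieldTheory.Balaban1983to89.B9Eq316PenaltyPointwiseBoundHeightFree

/-!
# `Balaban1983to89.B9Eq315QAdjointFarField` — T. Bałaban, *Propagators for lattice gauge theories in a background field*, Commun. Math. Phys. **99**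
# (1985) 389–434 [Balaban1985BackgroundPropagators] (3.15)–(3.16) p. 393 with p. 391, Thm 3.1 (3.42) p. 397, (3.49) p. 399, (3.35)–(3.37) p. 396 and
# [Balaban1985Averaging] p. 24 («this definition is local … depends only on the bond variables … b ⊂ B^k(c₋) ∪ B^k(c₊)»), (126)–(127) pp. 36–37:
# **THE AVERAGING HAS RANGE ONE BLOCK, SO ITS ADJOINT's FAR BLOCK PIECES VANISH AND THE `Q†` BLOCK LETTER `hQa` OF THE `H₁` ROW FOLLOWS FROM ANY OPERATOR
# BOUND — `1 < d_m(u,v) ⟹ P_v ∘ Q(U)† ∘ r_u = 0` (one step `QtorusW` and tower `QkW`), hence `‖P_{z′} ∘ Q†∘ r_z‖ ≤ C_Q·e^{r}·e^{−r·d_m(z,z′)}` for every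
# `r ≥ 0` from `‖Qf‖ ≤ C_Q‖f‖`; instances at this lineage's `hQ` letters: every background of the class (one step) and HEIGHT-FREE on a geometric bond-window
# profile (tower; on print's diagonal `C_Q† = M_φ′M_φ·exp(√(L^d)√(2d)·102(d+1)²L·ε_s∕(1−ρ))·e^{r}`, NO `k`, NO `η`)** — located remark N51 of the pub-balaban
# NE9 crux-ideation lens 1 (t4-ne9-idea-1 g150, `t4/ideate/NE9/lens1-g150/N51-CQADJ-FAR-g150.md`; kernel-checked scratch `…/lean/NE9AdjointFar…NOT-TO-FILE.lean`,
# whose §§0–2 this file's §0 ∕ §2 ∕ §3 reproduce token for token, credit theirs) typed as a tree module under fallback offer O-leaf01-g87-1 (journal l.62533),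
# importing ne9-leaf-03's (HQA) `B9Eq315QAdjointBlockDecay` BY NAME instead of copying its lemmas

statement-level skeleton of published theorems with citation tags; proofs where landed; nothing here is a claim about the Yang–Mills mass gap

CITATION HEADER (lean-in-tree rule).  Audit cell `pub-balaban`, sub-cell `t4`, BINDER row NE9; filed by NE9 formalisation-swarm LEAF PROVER 01
(`b2b-balaban-t4-ne9-formalise-leaf-01`, gen 87), INTENT I-ne9leaf01-g87-3, composing BY NAME: ne9-leaf-03's (HQA) `B9Eq315QAdjointBlockDecay`
(`adjoint_block_eq`, `toCLM_adjoint_eq`, `norm_block_QtorusW_le`, `norm_block_QkW_le`) and (H1L)∕(H1LT) `B9Eq3126H1BlockDecayOfLetters(Tower).norm_block_adjointQ(k)_le_of_far`,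
this lineage's `B9Eq316PenaltyPointwiseBound.norm_QtorusW_le` and `B9Eq316PenaltyPointwiseBoundHeightFree.norm_QkW_le_of_geometric_window(_diagonal)`; the
mechanism and the Lean text of §0, §2, §3 (first three theorems) are t4-ne9-idea-1 g150's (N51, W-2 l.62443, W-5 l.62540 «free for any NE9-crew filer to use
token for token»).  Sources READ by this seat in the held text layer `paper:balaban1985-cmp99-background-propagators` (journal page = PDF page + 388): p. 393
(3.15)–(3.16) (quoted in `B9Eq316PenaltyPointwiseBound`'s header); p. 399 (3.49) *«For the operator P = I − R we obtain, using again Lemma 2.1, [|P(x,x′)|, |(DP)_μ(x,x′)|,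
|(PD*)_ν(x,x′)|, |(DPD*)_{μν}(x,x′)|] ≤ O(1)… for x ∈ Δ(y), y ∈ Λ_j, x′ ∈ Δ(y′), y′ ∈ Λ_{j′}. (3.49)»* (the block-kernel currency).  [B7] p. 24 and (126)–(127)
through the tree's verbatim quotations in `B9Eq315QkLocalLetter` ∕ `B7Prop3GeneralLinearBound`.  NOTHING of print's random-walk proof is reproduced.

WHY THIS FILE (cell context).  The `H₁`-row assemblies (EH1)∕(EH1T) display a `Q†` block letter `hQa : ‖P_{z′}Q†r_z‖ ≤ C_Q†·e^{r}e^{−r d_m}`; its tree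
inhabitant (HQA) reads `C_Q†` with the factor `√(d·c₁)∕√c₀ = √d·L^{(n+1)d∕2}` on print's tower diagonal — NOT height-free (ne9-leaf-06 g81 W-g81-9 (β),
t4-ne9-idea-1 L-g149-9, desk V155 (β)).  N51's observation: the averaging's range is ONE block, so the block pieces at `d_m > 1` are ZERO (not merely small),
and (H1L)∕(H1LT)'s `…_le_of_far` then gives `C_Q† := C_Q·e^{r}` from ANY `L²` bound `C_Q` — with this lineage's height-free tower `hQ` the letter is height-free
BY TYPE; no new estimate (`‖Q†‖ = ‖Q‖`, `‖P‖, ‖r‖ ≤ 1`).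

WHAT IS PROVED (sorry-free; proof lane — no `def`; [folklore] bookkeeping BY NAME; nothing of [B9] asserted).
* §0 **`eq_zero_of_le_exp_all`** — `0 ≤ a ≤ K·e^{κ}·e^{−κt}` for every `κ ≥ 0`, `t > 1` ⟹ `a = 0`.
* §1 ONE STEP (`QtorusW`; the (HQA) one-step block families `P_y`, `r_y` displayed by their defining equations): **`block_QtorusW_eq_zero_of_far`**,
  **`block_adjoint_QtorusW_eq_zero_of_far`** (`1 < d_m ⟹` the pieces vanish), **`norm_block_adjoint_QtorusW_le_of_opNorm`** (`hQa` from any `hQ`, `ρ_Q = 1`),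
  **`norm_block_adjoint_QtorusW_le_of_class`** (at `hQ := norm_QtorusW_le`: every background of the class, no window).
* §2 TOWER (`QkW`, `k = n+1`): **`block_QkW_eq_zero_of_far`**, **`block_adjoint_QkW_eq_zero_of_far`**.
* §3 **`norm_block_adjoint_QkW_le_of_opNorm`** (N51's junction: `hQa` from any tower `hQ`), **`norm_block_adjoint_QkW_le_of_geometric_window`** (at the height-free
  `hQ` of `…HeightFree`: `C_Q† = M_φ′M_φ√(c₁∕(c₀(L^k)^d))·exp(…)·e^{r}`), **`…_diagonal`** (`c₁ = c₀(L^k)^d`: NO `k`, NO `η`).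
MODEL ∕ DECLARED READINGS.  As (HQA): periodic lattices, fibre along `φ` (`M_φ`, `M_φ′`), weights `c₀`, `c₁`, the background through the averaging's displayed
regularity letters (`α ≤ 1∕64` ∕ `α_j`, unit-ball extended bond variables, block-loop regularity) with `α ≥ 0` ∕ `α_j ≥ 0` and `1 ≤ m_i` displayed as there; the
indicator block families by their equations; §3's profile `(ε_s, ρ)` displayed (print's (3.35)–(3.37), the consumer's reading).  The far field starts at block
distance `2` (`1 < d_m`); at `d_m ≤ 1` the bound is the plain `hQ·e^{r}` — nothing sharper is claimed.
HONEST SCOPE.  Plumbing: one displayed letter of the `H₁` row re-supplied height-free from tree letters; NOT Thm 3.1 ∕ 3.2 ∕ 3.3; NOT NE9 (cell pub-balaban: NE9 NOT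
PRINTED ∕ NOT PROVED; «NE9 ⇐ the named binders»; row WALLED ON A MODEL (O-NE9-1; #5 UNRULED); spine PROVED 0∕9; rung (B)+1 on a finite T⁴ — NOT infinite volume,
NOT mass gap, NOT BetaPertH, NOT Clay; HONEST DEPENDENCY: continuum YM on T⁴ ⇐ BetaPertH ∧ nine spine estimates (0/9 proved); BetaPertH ⇐ (D1) ∧ (D4) ∧ CAP+tail;
G-an2-4 gates asym, D1 and NE2/3/4).  NEW file importing `B9Eq315QAdjointBlockDecay`, `B9Eq3126H1BlockDecayOfLetters(Tower)`, `B9Eq316PenaltyPointwiseBoundHeightFree`;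
nothing modified.  Net new unproved facts: 0.
-/

noncomputable section

open scoped InnerProductSpace ComplexConjugate BigOperators

namespace Literature.MathematicalPhysics.QuantumFieldTheory.Balaban1983to89.B9Eq315QAdjointFarField

open B4Sect5Torus (TSite tdist)
open B9SectCLatticeCarrier (Bond bpos)
open B7Prop1Explicit (U1 Wcx boxVec)
open B9Eq311L2Pairing (WL2)
open B11Eq103H1Complex (BondL2K)
open B9Eq319QprimeTorus (fineP blockCoord)
open B9Eq315QTorus (perCfg cornerSite QtorusW)
open B9Eq315QTower (towerP UlevOf)
open B9Eq316TowerFlatIsOneStep (siteCast towerP_eq_fineP_pow)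
open B9Eq326OperatorTower (QkW)
open B9Eq315QAdjointBlockDecay (adjoint_block_eq toCLM_adjoint_eq norm_block_QtorusW_le norm_block_QkW_le)
open B9Eq3126H1BlockDecayOfLetters (norm_block_adjointQ_le_of_far)
open B9Eq3126H1BlockDecayOfLettersTower (norm_block_adjointQk_le_of_far)
open B9Eq316PenaltyPointwiseBound (norm_QtorusW_le norm_QtorusW_le_of_window)
open B9Eq316PenaltyPointwiseBoundHeightFree (norm_QkW_le_of_geometric_window norm_QkW_le_of_geometric_window_diagonal)

/-! ## §0 Real analysis: a quantity below `K·e^{κ(1−t)}` for every `κ ≥ 0`, `t > 1`, vanishes -/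

/-- A nonnegative real bounded by `K·e^{κ}·e^{−κt}` for every `κ ≥ 0`, with `t > 1`, is `0` (`e^{−x} ≤ 1∕(1+x)` at a large `κ`). [folklore]
(text: t4-ne9-idea-1 g150's kernel-checked scratch `NE9AdjointFar`, N51) [cite: Balaban1985BackgroundPropagators, (3.42) p.397] -/
theorem eq_zero_of_le_exp_all {a K t : ℝ} (ha : 0 ≤ a) (hK : 0 ≤ K) (ht : 1 < t)
    (h : ∀ κ : ℝ, 0 ≤ κ → a ≤ K * Real.exp κ * Real.exp (-(κ * t))) : a = 0 := by
  by_contra hne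
  have ha' : 0 < a := lt_of_le_of_ne ha (Ne.symm hne)
  have ht1 : 0 < t - 1 := by linarith
  have hx0 : a * (t - 1) ≠ 0 := (mul_pos ha' ht1).ne'
  set κ : ℝ := K / (a * (t - 1)) + 1 with hκdef
  have hκ0 : 0 ≤ κ := by
    rw [hκdef]; exact add_nonneg (div_nonneg hK (mul_pos ha' ht1).le) zero_le_one
  have hx : 0 < 1 + κ * (t - 1) := by
    have := mul_nonneg hκ0 ht1.le; linarith
  have hexp : Real.exp κ * Real.exp (-(κ * t)) = Real.exp (-(κ * (t - 1))) := by
    rw [← Real.exp_add]; congr 1; ring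
  have hbound : Real.exp (-(κ * (t - 1))) ≤ 1 / (1 + κ * (t - 1)) := by
    rw [le_div_iff₀ hx]
    have h1 : 1 + κ * (t - 1) ≤ Real.exp (κ * (t - 1)) := by
      have := Real.add_one_le_exp (κ * (t - 1)); linarith
    calc Real.exp (-(κ * (t - 1))) * (1 + κ * (t - 1)) ≤ Real.exp (-(κ * (t - 1))) * Real.exp (κ * (t - 1)) :=
          mul_le_mul_of_nonneg_left h1 (Real.exp_nonneg _)
      _ = 1 := by rw [← Real.exp_add]; simp
  have hle : a ≤ K / (1 + κ * (t - 1)) := by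
    calc a ≤ K * Real.exp κ * Real.exp (-(κ * t)) := h κ hκ0
      _ = K * (Real.exp κ * Real.exp (-(κ * t))) := by ring
      _ = K * Real.exp (-(κ * (t - 1))) := by rw [hexp]
      _ ≤ K * (1 / (1 + κ * (t - 1))) := mul_le_mul_of_nonneg_left hbound hK
      _ = K / (1 + κ * (t - 1)) := by ring
  rw [le_div_iff₀ hx] at hle
  have hKa : κ * (a * (t - 1)) = K + a * (t - 1) := by
    rw [hκdef, add_mul, div_mul_cancel₀ K hx0, one_mul]
  have h3 : a * (1 + κ * (t - 1)) = a + κ * (a * (t - 1)) := by ring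
  rw [h3, hKa] at hle
  linarith [mul_pos ha' ht1]


/-! ## §1 One step: far block pieces of `Q(U)` and `Q(U)†` vanish; the `Q†` block letter from ANY operator bound -/

section OneStep

variable {d : ℕ} (L : ℕ) [NeZero L] (m : Fin d → ℕ) [∀ i, NeZero (m i)] [∀ i, NeZero (fineP L m i)]
  {𝔸 : Type*} [NormedRing 𝔸] [NormedAlgebra ℂ 𝔸] [CompleteSpace 𝔸] [NormOneClass 𝔸] (hL : 1 ≤ L)
  (U : Bond d (fineP L m) → 𝔸ˣ) {α : ℝ} (hα1 : α ≤ 1 / 64)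
  (hU1 : ∀ (x : B7Prop1Explicit.Site d) (κ : Fin d), perCfg (fineP L m) U x κ ∈ U1 𝔸)
  (hreg : ∀ (y : TSite d m) (κ : Fin d) (r : Fin d → Fin L),
    ‖((Wcx L (perCfg (fineP L m) U) (cornerSite L y) κ (boxVec L r) : 𝔸ˣ) : 𝔸) - 1‖ ≤ α)
  {W : Type*} [NormedAddCommGroup W] [InnerProductSpace ℂ W] [FiniteDimensional ℂ W] (φ : W ≃ₗ[ℂ] 𝔸) {c₀ c₁ : ℝ} [Fact (0 < c₀)] [Fact (0 < c₁)]
  {Mφ Mφ' : ℝ} (hφ : ∀ w, ‖φ w‖ ≤ Mφ * ‖w‖) (hφ' : ∀ X, ‖φ.symm X‖ ≤ Mφ' * ‖X‖) (hMφ : 0 ≤ Mφ) (hMφ' : 0 ≤ Mφ')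
  {PB : TSite d m → BondL2K ℂ d (fineP L m) c₀ W →L[ℂ] BondL2K ℂ d (fineP L m) c₀ W}
  (hPB : ∀ (y : TSite d m) (f : BondL2K ℂ d (fineP L m) c₀ W) (b : Bond d (fineP L m)),
    WL2.equiv ℂ (fun _ : Bond d (fineP L m) => c₀) W (PB y f) b =
      if blockCoord L m (bpos b) = y then WL2.equiv ℂ (fun _ : Bond d (fineP L m) => c₀) W f b else 0)
  {rF : TSite d m → BondL2K ℂ d m c₁ W →L[ℂ] BondL2K ℂ d m c₁ W}
  (hrF : ∀ (y : TSite d m) (g : BondL2K ℂ d m c₁ W) (b' : Bond d m),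
    WL2.equiv ℂ (fun _ : Bond d m => c₁) W (rF y g) b' = if bpos b' = y then WL2.equiv ℂ (fun _ : Bond d m => c₁) W g b' else 0)

include hφ hφ' hMφ hMφ' hPB hrF in
/-- **FAR BLOCK PIECES OF `Q(U)` VANISH (one step)**: `1 < d_m(u,v)` ⟹ `r_u ∘ Q(U) ∘ P_v = 0` — ne9-leaf-03's `norm_block_QtorusW_le` for EVERY `κ ≥ 0`; §0.
[folklore] [cite: Balaban1985BackgroundPropagators, (3.15) p.393; Balaban1985Averaging, p.24] -/
theorem block_QtorusW_eq_zero_of_far (hm : ∀ i, 1 ≤ m i) (hα0 : 0 ≤ α) {u v : TSite d m} (huv : 1 < tdist m u v) :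
    rF u ∘L LinearMap.toContinuousLinearMap (QtorusW L m hL φ U hα1 hU1 hreg (c₀ := c₀) (c₁ := c₁)) ∘L PB v = 0 := by
  have hK : 0 ≤ Mφ' * Mφ * (1 + 50 * (d + 1) * α) * Real.sqrt (d * c₁) / Real.sqrt c₀ := by positivity
  have h0 : ‖rF u ∘L LinearMap.toContinuousLinearMap (QtorusW L m hL φ U hα1 hU1 hreg (c₀ := c₀) (c₁ := c₁)) ∘L PB v‖ = 0 :=
    eq_zero_of_le_exp_all (norm_nonneg (rF u ∘L LinearMap.toContinuousLinearMap (QtorusW L m hL φ U hα1 hU1 hreg (c₀ := c₀) (c₁ := c₁)) ∘L PB v))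
      hK huv fun κ hκ =>
        calc _ ≤ _ := norm_block_QtorusW_le L m hL U hα1 hU1 hreg φ hφ hφ' hMφ hMφ' hPB hrF hm hκ hα0 u v
          _ = _ := by ring
  exact (ContinuousLinearMap.opNorm_zero_iff _).mp h0

include hφ hφ' hMφ hMφ' hPB hrF in
/-- **FAR BLOCK PIECES OF `Q(U)†` VANISH (one step)**: `1 < d_m(u,v)` ⟹ `P_v ∘ Q(U)† ∘ r_u = 0` — the `hfar` letter of
`B9Eq3126H1BlockDecayOfLetters.norm_block_adjointQ_le_of_far` at range `ρ_Q = 1`. [folklore] [cite: Balaban1985BackgroundPropagators, p.391, (3.15) p.393, (3.49) p.399] -/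
theorem block_adjoint_QtorusW_eq_zero_of_far (hm : ∀ i, 1 ≤ m i) (hα0 : 0 ≤ α) {u v : TSite d m} (huv : 1 < tdist m u v) :
    PB v ∘L LinearMap.toContinuousLinearMap (LinearMap.adjoint (QtorusW L m hL φ U hα1 hU1 hreg (c₀ := c₀) (c₁ := c₁))) ∘L rF u = 0 := by
  have h : PB v ∘L ContinuousLinearMap.adjoint (LinearMap.toContinuousLinearMap (QtorusW L m hL φ U hα1 hU1 hreg (c₀ := c₀) (c₁ := c₁))) ∘L rF u =
      ContinuousLinearMap.adjoint (rF u ∘L LinearMap.toContinuousLinearMap (QtorusW L m hL φ U hα1 hU1 hreg (c₀ := c₀) (c₁ := c₁)) ∘L PB v) := by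
    rw [ContinuousLinearMap.adjoint_comp, ContinuousLinearMap.adjoint_comp, adjoint_block_eq hPB, adjoint_block_eq hrF,
      ContinuousLinearMap.comp_assoc]
  rw [toCLM_adjoint_eq, h, block_QtorusW_eq_zero_of_far L m hL U hα1 hU1 hreg φ hφ hφ' hMφ hMφ' hPB hrF hm hα0 huv]
  exact map_zero _

include hφ hφ' hMφ hMφ' hPB hrF in
/-- **THE `Q†` BLOCK LETTER `hQa` FROM AN OPERATOR BOUND (one step)**: `‖Q(U)f‖ ≤ C_Q‖f‖` ⟹ `‖P_{z′} ∘ Q(U)† ∘ r_z‖ ≤ C_Q·e^{r·1}·e^{−r·d_m(z,z′)}` for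
every `r ≥ 0` — `B9Eq3126H1BlockDecayOfLetters.norm_block_adjointQ_le_of_far` at `ρ_Q := 1` with `hfar :=` the previous theorem; NO `√(d·c₁)∕√c₀`.
[folklore] (composition) [cite: Balaban1985BackgroundPropagators, (3.15)–(3.16) p.393, (3.42) p.397, (3.49) p.399] -/
theorem norm_block_adjoint_QtorusW_le_of_opNorm (hm : ∀ i, 1 ≤ m i) (hα0 : 0 ≤ α) {CQ r : ℝ} (hCQ : 0 ≤ CQ) (hr : 0 ≤ r)
    (hQ : ∀ f, ‖(QtorusW L m hL φ U hα1 hU1 hreg (c₀ := c₀) (c₁ := c₁)) f‖ ≤ CQ * ‖f‖) (z z' : TSite d m) :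
    ‖PB z' ∘L LinearMap.toContinuousLinearMap (LinearMap.adjoint (QtorusW L m hL φ U hα1 hU1 hreg (c₀ := c₀) (c₁ := c₁))) ∘L rF z‖ ≤
      CQ * Real.exp (r * 1) * Real.exp (-(r * tdist m z z')) :=
  norm_block_adjointQ_le_of_far hPB hrF hCQ hr hQ
    (fun _ _ huv => block_adjoint_QtorusW_eq_zero_of_far L m hL U hα1 hU1 hreg φ hφ hφ' hMφ hMφ' hPB hrF hm hα0 huv) z z'

include hφ hφ' hMφ hMφ' hPB hrF in
/-- **`hQa` AT EVERY BACKGROUND OF THE CLASS (one step)**: for every `r ≥ 0`,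
`‖P_{z′} ∘ Q(U)† ∘ r_z‖ ≤ M_φ′M_φ(1 + 50(d+1)α)√(2d·c₁∕c₀)·e^{r}·e^{−r·d_m(z,z′)}` — the previous theorem at `hQ := B9Eq316PenaltyPointwiseBound.norm_QtorusW_le`
(no window; `√(2d·c₁∕c₀) = √(2d·L^d)` on the one-step diagonal `c₁ = L^d c₀`, where (HQA)'s `√(d·c₁)∕√c₀·e^{κ}` reads `√(d·L^d)·e^{κ}` — the same order at one
step; the height-free gain is the tower's, §3). [folklore] (composition) [cite: Balaban1985BackgroundPropagators, (3.15)–(3.16) p.393, (3.49) p.399; Balaban1985Averaging, (126) p.36] -/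
theorem norm_block_adjoint_QtorusW_le_of_class (hm : ∀ i, 1 ≤ m i) (hα0 : 0 ≤ α) {r : ℝ} (hr : 0 ≤ r) (z z' : TSite d m) :
    ‖PB z' ∘L LinearMap.toContinuousLinearMap (LinearMap.adjoint (QtorusW L m hL φ U hα1 hU1 hreg (c₀ := c₀) (c₁ := c₁))) ∘L rF z‖ ≤
      Mφ' * Mφ * (1 + 50 * (d + 1) * α) * Real.sqrt (2 * d * c₁ / c₀) * Real.exp (r * 1) * Real.exp (-(r * tdist m z z')) :=
  norm_block_adjoint_QtorusW_le_of_opNorm L m hL U hα1 hU1 hreg φ hφ hφ' hMφ hMφ' hPB hrF hm hα0 (by positivity) hr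
    (norm_QtorusW_le L m hL U hα1 hU1 hreg φ hMφ hφ hMφ' hφ' (c₁ := c₁)) z z'

end OneStep

/-! ## §2 The tower: far block pieces of `Q_k(U)` and of `Q_k(U)†` vanish -/

section Tower

variable {d : ℕ} (L : ℕ) [NeZero L] (m : Fin d → ℕ) [∀ i, NeZero (m i)] (n : ℕ)
  {𝔸 : Type*} [NormedRing 𝔸] [NormedAlgebra ℂ 𝔸] [CompleteSpace 𝔸] [NormOneClass 𝔸]
  {W : Type*} [NormedAddCommGroup W] [InnerProductSpace ℂ W] [FiniteDimensional ℂ W] (φ : W ≃ₗ[ℂ] 𝔸) {c₀ c₁ : ℝ} [Fact (0 < c₀)] [Fact (0 < c₁)]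
  (U : Bond d (towerP L m (n + 1)) → 𝔸ˣ) (hL : 1 ≤ L) (α : ℕ → ℝ) (hα1 : ∀ j, α j ≤ 1 / 64)
  (hU1 : ∀ (j : ℕ) (x : B7Prop1Explicit.Site d) (κ : Fin d), perCfg (towerP L m (j + 1)) (UlevOf L m (n + 1) U j) x κ ∈ U1 𝔸)
  (hreg : ∀ (j : ℕ) (y : TSite d (towerP L m j)) (κ : Fin d) (r : Fin d → Fin L),
    ‖((Wcx L (perCfg (towerP L m (j + 1)) (UlevOf L m (n + 1) U j)) (cornerSite L y) κ (boxVec L r) : 𝔸ˣ) : 𝔸) - 1‖ ≤ α j)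
  {Mφ Mφ' : ℝ} (hφ : ∀ w, ‖φ w‖ ≤ Mφ * ‖w‖) (hφ' : ∀ X, ‖φ.symm X‖ ≤ Mφ' * ‖X‖) (hMφ : 0 ≤ Mφ) (hMφ' : 0 ≤ Mφ')
  {PB : TSite d m → BondL2K ℂ d (towerP L m (n + 1)) c₀ W →L[ℂ] BondL2K ℂ d (towerP L m (n + 1)) c₀ W}
  (hPB : ∀ (y : TSite d m) (f : BondL2K ℂ d (towerP L m (n + 1)) c₀ W) (b : Bond d (towerP L m (n + 1))),
    WL2.equiv ℂ (fun _ : Bond d (towerP L m (n + 1)) => c₀) W (PB y f) b =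
      if blockCoord (L ^ (n + 1)) m (siteCast (towerP_eq_fineP_pow L m (n + 1)) (bpos b)) = y then
        WL2.equiv ℂ (fun _ : Bond d (towerP L m (n + 1)) => c₀) W f b else 0)
  {rF : TSite d m → BondL2K ℂ d m c₁ W →L[ℂ] BondL2K ℂ d m c₁ W}
  (hrF : ∀ (y : TSite d m) (g : BondL2K ℂ d m c₁ W) (b' : Bond d m),
    WL2.equiv ℂ (fun _ : Bond d m => c₁) W (rF y g) b' = if bpos b' = y then WL2.equiv ℂ (fun _ : Bond d m => c₁) W g b' else 0)

include hφ hφ' hMφ hMφ' hPB hrF in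
/-- **FAR BLOCK PIECES OF `Q_k(U)` VANISH**: `1 < d_m(u,v)` ⟹ `r_u ∘ Q_k(U) ∘ P_v = 0` — ne9-leaf-03's `L²` block letter
`B9Eq315QAdjointBlockDecay.norm_block_QkW_le` holds for EVERY `κ ≥ 0`; §0. [folklore] (text: t4-ne9-idea-1 g150, N51)
[cite: Balaban1985BackgroundPropagators, (3.15)–(3.16) p.393; Balaban1985Averaging, p.24, (127) p.37] -/
theorem block_QkW_eq_zero_of_far (hm : ∀ i, 1 ≤ m i) (hα0 : ∀ j, 0 ≤ α j) {u v : TSite d m} (huv : 1 < tdist m u v) :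
    rF u ∘L LinearMap.toContinuousLinearMap (QkW L m n φ U hL α hα1 hU1 hreg (c₀ := c₀) (c₁ := c₁)) ∘L PB v = 0 := by
  have hprod : 0 ≤ ∏ j ∈ Finset.range (n + 1), (1 + 50 * (d + 1) * α j) := Finset.prod_nonneg fun j _ => by nlinarith [hα0 j]
  have hK : 0 ≤ Mφ' * Mφ * (∏ j ∈ Finset.range (n + 1), (1 + 50 * (d + 1) * α j)) * Real.sqrt (d * c₁) / Real.sqrt c₀ :=
    div_nonneg (mul_nonneg (mul_nonneg (mul_nonneg hMφ' hMφ) hprod) (Real.sqrt_nonneg _)) (Real.sqrt_nonneg _)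
  have h0 : ‖rF u ∘L LinearMap.toContinuousLinearMap (QkW L m n φ U hL α hα1 hU1 hreg (c₀ := c₀) (c₁ := c₁)) ∘L PB v‖ = 0 :=
    eq_zero_of_le_exp_all (norm_nonneg (rF u ∘L LinearMap.toContinuousLinearMap (QkW L m n φ U hL α hα1 hU1 hreg (c₀ := c₀) (c₁ := c₁)) ∘L PB v))
      hK huv fun κ hκ =>
        calc _ ≤ _ := norm_block_QkW_le L m n φ U hL α hα1 hU1 hreg hφ hφ' hMφ hMφ' hPB hrF hm hκ hα0 u v
          _ = _ := by ring
  exact (ContinuousLinearMap.opNorm_zero_iff _).mp h0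

include hφ hφ' hMφ hMφ' hPB hrF in
/-- **FAR BLOCK PIECES OF `Q_k(U)†` VANISH**: `1 < d_m(u,v)` ⟹ `P_v ∘ Q_k(U)† ∘ r_u = 0` — the adjoint identity for the self-adjoint block families
(ne9-leaf-03's `adjoint_block_eq`, `toCLM_adjoint_eq`) and the previous theorem: the `hfar` letter of `B9Eq3126H1BlockDecayOfLettersTower` at range `ρ_Q = 1`.
[folklore] (text: t4-ne9-idea-1 g150, N51) [cite: Balaban1985BackgroundPropagators, p.391, (3.15)–(3.16) p.393, (3.49) p.399] -/
theorem block_adjoint_QkW_eq_zero_of_far (hm : ∀ i, 1 ≤ m i) (hα0 : ∀ j, 0 ≤ α j) {u v : TSite d m} (huv : 1 < tdist m u v) :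
    PB v ∘L LinearMap.toContinuousLinearMap (LinearMap.adjoint (QkW L m n φ U hL α hα1 hU1 hreg (c₀ := c₀) (c₁ := c₁))) ∘L rF u = 0 := by
  have h : PB v ∘L ContinuousLinearMap.adjoint (LinearMap.toContinuousLinearMap (QkW L m n φ U hL α hα1 hU1 hreg (c₀ := c₀) (c₁ := c₁))) ∘L rF u =
      ContinuousLinearMap.adjoint (rF u ∘L LinearMap.toContinuousLinearMap (QkW L m n φ U hL α hα1 hU1 hreg (c₀ := c₀) (c₁ := c₁)) ∘L PB v) := by
    rw [ContinuousLinearMap.adjoint_comp, ContinuousLinearMap.adjoint_comp, adjoint_block_eq hPB, adjoint_block_eq hrF,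
      ContinuousLinearMap.comp_assoc]
  rw [toCLM_adjoint_eq, h, block_QkW_eq_zero_of_far L m n φ U hL α hα1 hU1 hreg hφ hφ' hMφ hMφ' hPB hrF hm hα0 huv]
  exact map_zero _

/-! ## §3 The tower `Q_k†` block letter from ANY operator bound (range `ρ_Q = 1`), and its height-free instance -/

include hφ hφ' hMφ hMφ' hPB hrF in
/-- **THE `Q_k†` LETTER OF THE TOWER `H₁` ROW FROM AN OPERATOR BOUND**: `‖Q_k(U)f‖ ≤ C_Q‖f‖` ⟹ `‖P_{z′} ∘ Q_k(U)† ∘ r_z‖ ≤ C_Q·e^{r·1}·e^{−r·d_m(z,z′)}`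
for every `r ≥ 0` — ne9-leaf-03's `B9Eq3126H1BlockDecayOfLettersTower.norm_block_adjointQk_le_of_far` at `ρ_Q := 1`, `hfar :=` §1; NO window, NO
`√(d·c₁)∕√c₀`. [folklore] (composition; text: t4-ne9-idea-1 g150, N51) [cite: Balaban1985BackgroundPropagators, (3.15)–(3.16) p.393, (3.42) p.397, (3.49) p.399] -/
theorem norm_block_adjoint_QkW_le_of_opNorm (hm : ∀ i, 1 ≤ m i) (hα0 : ∀ j, 0 ≤ α j) {CQ r : ℝ} (hCQ : 0 ≤ CQ) (hr : 0 ≤ r)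
    (hQ : ∀ f, ‖(QkW L m n φ U hL α hα1 hU1 hreg (c₀ := c₀) (c₁ := c₁)) f‖ ≤ CQ * ‖f‖) (z z' : TSite d m) :
    ‖PB z' ∘L LinearMap.toContinuousLinearMap (LinearMap.adjoint (QkW L m n φ U hL α hα1 hU1 hreg (c₀ := c₀) (c₁ := c₁))) ∘L rF z‖ ≤
      CQ * Real.exp (r * 1) * Real.exp (-(r * tdist m z z')) :=
  norm_block_adjointQk_le_of_far φ U hL α hα1 hU1 hreg hPB hrF hCQ hr hQ
    (fun _ _ huv => block_adjoint_QkW_eq_zero_of_far L m n φ U hL α hα1 hU1 hreg hφ hφ' hMφ hMφ' hPB hrF hm hα0 huv) z z'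

variable (εU : ℕ → ℝ) (hεU : ∀ j, 0 ≤ εU j)
  (hUε : ∀ (j : ℕ) (b : Bond d (towerP L m (j + 1))), ‖(UlevOf L m (n + 1) U j b : 𝔸) - 1‖ ≤ εU j)
  {ρ εs : ℝ} (hρ0 : 0 ≤ ρ) (hρ1 : ρ < 1) (hεs : 0 ≤ εs) (hεg : ∀ j < n + 1, εU j ≤ εs * ρ ^ j)

include hφ hφ' hMφ hMφ' hPB hrF hεU hUε hρ0 hρ1 hεs hεg in
/-- **THE `Q_k†` BLOCK LETTER, HEIGHT-FREE ON A GEOMETRIC BOND-WINDOW PROFILE** (`ε_j ≤ ε_s ρ^j`, `0 ≤ ρ < 1`): for every `r ≥ 0`,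
`‖P_{z′} ∘ Q_k(U)† ∘ r_z‖ ≤ M_φ′M_φ√(c₁∕(c₀(L^k)^d))·exp(√(L^d)√(2d)·102(d+1)²L·ε_s∕(1−ρ))·e^{r}·e^{−r·d_m(z,z′)}` — §2 at
`hQ := B9Eq316PenaltyPointwiseBoundHeightFree.norm_QkW_le_of_geometric_window`. [folklore] (composition)
[cite: Balaban1985BackgroundPropagators, (3.15)–(3.16) p.393, (3.35)–(3.37) p.396, (3.49) p.399] -/
theorem norm_block_adjoint_QkW_le_of_geometric_window (hm : ∀ i, 1 ≤ m i) (hα0 : ∀ j, 0 ≤ α j) {r : ℝ} (hr : 0 ≤ r) (z z' : TSite d m) :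
    ‖PB z' ∘L LinearMap.toContinuousLinearMap (LinearMap.adjoint (QkW L m n φ U hL α hα1 hU1 hreg (c₀ := c₀) (c₁ := c₁))) ∘L rF z‖ ≤
      Mφ' * Mφ * Real.sqrt (c₁ / (c₀ * ((L : ℝ) ^ (n + 1)) ^ d)) *
          Real.exp (Real.sqrt ((L : ℝ) ^ d) * (Real.sqrt (2 * d) * (102 * (d + 1) ^ 2 * L)) * (εs / (1 - ρ))) *
        Real.exp (r * 1) * Real.exp (-(r * tdist m z z')) :=
  norm_block_adjoint_QkW_le_of_opNorm L m n φ U hL α hα1 hU1 hreg hφ hφ' hMφ hMφ' hPB hrF hm hα0 (by positivity) hr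
    (norm_QkW_le_of_geometric_window L m n hL φ hMφ hMφ' hφ hφ' U α hα1 hU1 hreg εU hεU hUε hρ0 hρ1 hεs hεg (c₀ := c₀) (c₁ := c₁)) z z'

include hφ hφ' hMφ hMφ' hPB hrF hεU hUε hρ0 hρ1 hεs hεg in
/-- **… ON PRINT's DIAGONAL `c₁ = c₀(L^{n+1})^d`: `‖P_{z′} ∘ Q_k(U)† ∘ r_z‖ ≤ M_φ′M_φ·exp(√(L^d)√(2d)·102(d+1)²L·ε_s∕(1−ρ))·e^{r}·e^{−r·d_m(z,z′)}` — NO `k`,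
NO `η` ANYWHERE** (the `hQa` letter of the tower `H₁` row height-free BY TYPE). [folklore] (composition)
[cite: Balaban1985BackgroundPropagators, (3.15)–(3.16) p.393, (3.35)–(3.37) p.396, (3.49) p.399] -/
theorem norm_block_adjoint_QkW_le_of_geometric_window_diagonal (hc : c₁ = c₀ * ((L : ℝ) ^ (n + 1)) ^ d) (hm : ∀ i, 1 ≤ m i)
    (hα0 : ∀ j, 0 ≤ α j) {r : ℝ} (hr : 0 ≤ r) (z z' : TSite d m) :
    ‖PB z' ∘L LinearMap.toContinuousLinearMap (LinearMap.adjoint (QkW L m n φ U hL α hα1 hU1 hreg (c₀ := c₀) (c₁ := c₁))) ∘L rF z‖ ≤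
      Mφ' * Mφ * Real.exp (Real.sqrt ((L : ℝ) ^ d) * (Real.sqrt (2 * d) * (102 * (d + 1) ^ 2 * L)) * (εs / (1 - ρ))) *
        Real.exp (r * 1) * Real.exp (-(r * tdist m z z')) :=
  norm_block_adjoint_QkW_le_of_opNorm L m n φ U hL α hα1 hU1 hreg hφ hφ' hMφ hMφ' hPB hrF hm hα0 (by positivity) hr
    (norm_QkW_le_of_geometric_window_diagonal L m n hL φ hMφ hMφ' hφ hφ' U α hα1 hU1 hreg εU hεU hUε hρ0 hρ1 hεs hεg (c₀ := c₀) (c₁ := c₁) hc)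
    z z'

end Tower

end Literature.MathematicalPhysics.QuantumFieldTheory.Balaban1983to89.B9Eq315QAdjointFarField

end
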